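import Summits.QuantumFields.BalabanUV.Beta.RemainderExplicitHistoryDiagonalPositionMonotone
import Summits.QuantumFields.BalabanUV.Beta.RemainderExplicitHistoryDiagonalProfile

/-!
# RemainderExplicitHistoryDiagonalEmbedding — ROAD P3, ORDER-0 PROFILE FAMILY: THE INFRARED-PINNED RUN IS UNIQUE, EVERY PINNED RUN IS A
# MEMBER OF A PINNED FAMILY, THE CONTINUUM COUPLING DEPENDS ON `(β, g_IR)` ONLY — and therefore every «family form» theorem of the
# series is a theorem about TWO ARBITRARY pinned runs: the matched discrepancy with ANY shift `n` is non-increasing in the position, and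
# the continuum correction grows towards the ultraviolet end of EVERY pinned run (generation 55's located optional item «general shift
# `n` for two ARBITRARY runs — now via the family form only; needs uniqueness of pinned runs or a direct argument», settled by BOTH)

Cell `pub-balaban`, β-function sub-cell, BINDER row D4 «RemainderConst leaves for Bałaban's split» (`HOME/BINDER-OWNERS.md`; owner lineage
`b2b-balaban-beta-an4`; this file by co-owner #3 lineage `b2b-balaban-beta-d4-p3`, road P3 «the reduction road», generation 56; imports
generation 55's `RemainderExplicitHistoryDiagonalPositionMonotone` (the family form `invSq_shift_mono_position`, `astar_sub_invSq_mono_position`,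
and through it `…TwoRun.invSq_le_invSq_shift_run`, `…Monotone.continuum_monotone`) and generation 47's `RemainderExplicitHistoryDiagonalProfile`
(`runFamily_exists`)), β-FLOW TEAM duty (1); FREEZE (0) honoured (def-free module in road P3's own `RemainderExplicit*` series; no leaf, no
interface, no Literature file).  SOURCE OF THE SHAPES ONLY: [Balaban1987RG1] (0.20) p. 256, (0.31) and Thm 2 p. 259, §5 p. 298.  [folklore]
real analysis about ONE explicit toy family (ours), road P3's ORDER-0 PROFILE FAMILY `β_{k+1} = b + Σ_{i≤k} ρ(k−i)·min(g_k, |g_k − g_i|)`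
(generation 44).
HONEST FRAMING: *"Discharging BetaPertH makes Bałaban's UV stability UNCONDITIONAL — a real constructive-QFT result; it is NOT the continuum
limit and NOT the Clay problem."*  THIS FILE DISCHARGES NOTHING OF THE KIND; nothing of Bałaban's (1.22) is asserted or constructed; row D4
class UNCHANGED (critical-path width 0; instance 0∕1; D4 DISCHARGE NO DATE); NOT B12 Thm 2, NOT BetaPertH, NOT continuum, NOT Clay.  HONEST
DEPENDENCY: continuum YM on T⁴ ⇐ BetaPertH ∧ nine spine estimates (0/9 proved); BetaPertH ⇐ (D1) ∧ (D4) ∧ CAP+tail; G-an2-4 gates asym, D1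
and NE2/3/4.  ABSOLUTE RULE: nothing is cited as a fact.  All letters NOT-IN-PRINT; `BetaFlowAsPrinted S` records a Markov β_n only.

THE ARGUMENT.  (§1) Generation 48's maximum principle with shift `invSq_le_invSq_shift_run` holds for shift `n = 0`: two positive runs of the
SAME length with the SAME infrared pin satisfy `1∕(g^A_j)² ≤ 1∕(g^B_j)²` AND the reverse — the pinned run is unique (no smallness, no box, any
`ρ ≥ 0`).  Hence two pinned families with the same pin coincide run by run, and `invSq`, `astar` (the continuum coupling) are functions of
`(β, g_IR)` alone.  (§2) `runFamily_exists` (`2Wγ ≤ b`) gives SOME pinned box family at the pin `g^A_K`; overwriting its run of length `K` by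
the given run `A` (and of length `K + n`, `n ≠ 0`, by `B`) keeps every family hypothesis (`Function.update`).  (§3) So the family forms apply
to the given runs: `invSq_shift_mono_position` at `m = K − (j+1)` is literally the shift-`n` monotonicity for `A, B` (the case `n = 0` is `0 ≤ 0`
by uniqueness), and `astar_sub_invSq_mono_position` read on the embedded family is the growth of the continuum correction along `A`.

WHAT IS PROVED ([folklore]; 0 sorry; 0 `def`).
* §1 **`invSq_eq_of_pin`**, **`run_eq_of_pin`** (UNIQUENESS of the pinned run: same `K`, same `β`, same pin, positive ⟹ equal on `[0, K]`),
  `run_eq_family` (a pinned run IS the family's run of its length), **`invSq_eq_of_pin_eq`**, **`astar_eq_of_pin_eq`** (two pinned box∕positive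
  families with the same pin have the same `invSq` and the same `astar`: the continuum coupling is family-independent).
* §2 **`exists_family_through`** (every pinned box run of length `K` is the length-`K` member of a pinned box family, `2Wγ ≤ b`),
  **`exists_family_through_two`** (two pinned box runs of lengths `K`, `K + n`, `n ≠ 0`, matched pin, are members of ONE pinned box family).
* §3 **`disc_shift_succ_le_disc_shift`** (TWO ARBITRARY pinned box runs `A` (`K` steps), `B` (`K + n` steps), ANY `n`, profile non-increasing on
  the positive ages, `Σρ ≤ W`, `4Wγ ≤ b`: `1∕(g^B_{j+1+n})² − 1∕(g^A_{j+1})² ≤ 1∕(g^B_{j+n})² − 1∕(g^A_j)²` for every `j < K` — generation 55's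
  `disc_succ_le_disc` is `n = 1`), **`astar_sub_invSq_run_mono`** (for ONE arbitrary pinned box run `A` of length `K = j + 1 + m` and ANY pinned box
  family `g` at the same pin: `astar g m − 1∕(g^A_{j+1})² ≤ astar g (m+1) − 1∕(g^A_j)²`).
-/

noncomputable section

open Finset Filter Topology

namespace Summit.QuantumFields.BalabanUV.Beta.RemainderExplicitHistoryDiagonalEmbedding

open Literature.MathematicalPhysics.QuantumFieldTheory.Balaban1983to89
open Literature.MathematicalPhysics.QuantumFieldTheory.Balaban1983to89.FlowStep
open Literature.MathematicalPhysics.QuantumFieldTheory.Balaban1983to89.T4CouplingMatching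
open Literature.MathematicalPhysics.QuantumFieldTheory.Balaban1983to89.T4ContinuumCoupling
open Summit.QuantumFields.BalabanUV.Beta.RemainderExplicitHistoryDiagonalTwoRun
open Summit.QuantumFields.BalabanUV.Beta.RemainderExplicitHistoryDiagonalPositionMonotone
open Summit.QuantumFields.BalabanUV.Beta.RemainderExplicitHistoryDiagonalProfile

variable {β : HBeta} {b γ W : ℝ} {ρ : ℕ → ℝ}

/-! ## §1 Uniqueness of the infrared-pinned run; the continuum coupling is family-independent -/

/-- **UNIQUENESS IN THE RECURSION VARIABLE.**  Two positive runs of the family of the SAME length `K` with the SAME infrared pin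
`g^A_K = g^B_K` have `1∕(g^A_j)² = 1∕(g^B_j)²` for every `j ≤ K` — generation 48's maximum principle with shift `invSq_le_invSq_shift_run`
at shift `n = 0`, applied both ways.  No smallness, no box, any profile `ρ ≥ 0`. [folklore] -/
theorem invSq_eq_of_pin
    (hβ : ∀ (k : ℕ) (p : Fin (k + 1) → ℝ),
      β k p = b + ∑ i : Fin (k + 1), ρ (k - i) * min (p (Fin.last k)) (|p (Fin.last k) - p i|))
    (hb : 0 < b) (hρ0 : ∀ a, 0 ≤ ρ a) {K : ℕ} {gA gB : ℕ → ℝ} (hA : RGEqH K β gA) (hB : RGEqH K β gB)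
    (hApos : ∀ k, k ≤ K → 0 < gA k) (hBpos : ∀ k, k ≤ K → 0 < gB k) (hpin : gA K = gB K) :
    ∀ j, j ≤ K → 1 / (gA j) ^ 2 = 1 / (gB j) ^ 2 := fun j hj =>
  le_antisymm (invSq_le_invSq_shift_run (n := 0) hβ hb hρ0 hA hB hApos hBpos hpin j hj)
    (invSq_le_invSq_shift_run (n := 0) hβ hb hρ0 hB hA hBpos hApos hpin.symm j hj)

/-- **UNIQUENESS OF THE PINNED RUN.**  Two positive runs of the family of the same length `K` with the same infrared pin coincide on
`[0, K]`: the two-point problem «recursion (0.20) with the history-dependent `β` of the family on `k < K`, value at `K` prescribed» has at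
most one positive solution. [folklore] -/
theorem run_eq_of_pin
    (hβ : ∀ (k : ℕ) (p : Fin (k + 1) → ℝ),
      β k p = b + ∑ i : Fin (k + 1), ρ (k - i) * min (p (Fin.last k)) (|p (Fin.last k) - p i|))
    (hb : 0 < b) (hρ0 : ∀ a, 0 ≤ ρ a) {K : ℕ} {gA gB : ℕ → ℝ} (hA : RGEqH K β gA) (hB : RGEqH K β gB)
    (hApos : ∀ k, k ≤ K → 0 < gA k) (hBpos : ∀ k, k ≤ K → 0 < gB k) (hpin : gA K = gB K) :
    ∀ j, j ≤ K → gA j = gB j := fun j hj => by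
  have h := invSq_eq_of_pin hβ hb hρ0 hA hB hApos hBpos hpin j hj
  have hA0 := hApos j hj
  have hB0 := hBpos j hj
  have hsq : (gA j) ^ 2 = (gB j) ^ 2 := by
    have h' := congrArg (fun x : ℝ => 1 / x) h
    simpa only [one_div_one_div] using h'
  have hprod : (gA j - gB j) * (gA j + gB j) = 0 := by
    have : (gA j - gB j) * (gA j + gB j) = (gA j) ^ 2 - (gB j) ^ 2 := by ring
    rw [this, hsq, sub_self]
  rcases mul_eq_zero.1 hprod with h1 | h1
  · linarith
  · linarith

/-- **A PINNED RUN IS THE FAMILY'S RUN OF ITS LENGTH.**  For a pinned positive family `g` (`g K` the run with `K` steps, `g K K = g_IR`) and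
ANY positive run `A` of length `K` of the same family `β` pinned at the same `g_IR`: `A = g K` on `[0, K]`. [folklore] -/
theorem run_eq_family
    (hβ : ∀ (k : ℕ) (p : Fin (k + 1) → ℝ),
      β k p = b + ∑ i : Fin (k + 1), ρ (k - i) * min (p (Fin.last k)) (|p (Fin.last k) - p i|))
    (hb : 0 < b) (hρ0 : ∀ a, 0 ≤ ρ a) {g : ℕ → ℕ → ℝ} {gIR : ℝ} (hrun : ∀ K, RGEqH K β (g K))
    (hpos : ∀ K i, i ≤ K → 0 < g K i) (hpin : ∀ K, g K K = gIR) {K : ℕ} {gA : ℕ → ℝ} (hA : RGEqH K β gA)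
    (hApos : ∀ k, k ≤ K → 0 < gA k) (hApin : gA K = gIR) :
    ∀ j, j ≤ K → gA j = g K j :=
  run_eq_of_pin hβ hb hρ0 hA (hrun K) hApos (hpos K) (hApin.trans (hpin K).symm)

/-- **TWO PINNED FAMILIES WITH THE SAME PIN HAVE THE SAME RECURSION VARIABLE** `invSq g = invSq g'` (`invSq g m n = 1∕(g^{(n+m)}_n)²`):
the runs of length `n + m` of both families coincide on `[0, n+m]` by `run_eq_of_pin`. [folklore] -/
theorem invSq_eq_of_pin_eq
    (hβ : ∀ (k : ℕ) (p : Fin (k + 1) → ℝ),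
      β k p = b + ∑ i : Fin (k + 1), ρ (k - i) * min (p (Fin.last k)) (|p (Fin.last k) - p i|))
    (hb : 0 < b) (hρ0 : ∀ a, 0 ≤ ρ a) {g g' : ℕ → ℕ → ℝ} {gIR : ℝ} (hrun : ∀ K, RGEqH K β (g K))
    (hrun' : ∀ K, RGEqH K β (g' K)) (hpos : ∀ K i, i ≤ K → 0 < g K i) (hpos' : ∀ K i, i ≤ K → 0 < g' K i)
    (hpin : ∀ K, g K K = gIR) (hpin' : ∀ K, g' K K = gIR) : invSq g = invSq g' := by
  funext m n
  rw [invSq_def, invSq_def,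
    run_eq_of_pin hβ hb hρ0 (hrun (n + m)) (hrun' (n + m)) (hpos (n + m)) (hpos' (n + m))
      ((hpin (n + m)).trans (hpin' (n + m)).symm) n (Nat.le_add_right n m)]

/-- **THE CONTINUUM COUPLING IS FAMILY-INDEPENDENT**: two pinned positive families of the same `β` with the same pin have the same
`astar` (`astar g m = lim_n invSq g m n`, the continuum recursion variable at infrared distance `m`) — it is a function of `(β, g_IR)` alone.
[folklore] -/
theorem astar_eq_of_pin_eq
    (hβ : ∀ (k : ℕ) (p : Fin (k + 1) → ℝ),
      β k p = b + ∑ i : Fin (k + 1), ρ (k - i) * min (p (Fin.last k)) (|p (Fin.last k) - p i|))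
    (hb : 0 < b) (hρ0 : ∀ a, 0 ≤ ρ a) {g g' : ℕ → ℕ → ℝ} {gIR : ℝ} (hrun : ∀ K, RGEqH K β (g K))
    (hrun' : ∀ K, RGEqH K β (g' K)) (hpos : ∀ K i, i ≤ K → 0 < g K i) (hpos' : ∀ K i, i ≤ K → 0 < g' K i)
    (hpin : ∀ K, g K K = gIR) (hpin' : ∀ K, g' K K = gIR) : astar g = astar g' := by
  funext m
  show limUnder atTop (invSq g m) = limUnder atTop (invSq g' m)
  rw [invSq_eq_of_pin_eq hβ hb hρ0 hrun hrun' hpos hpos' hpin hpin']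

/-! ## §2 Every pinned box run is a member of a pinned box family -/

/-- **EMBEDDING ONE RUN.**  A box run `A` of length `K` of the family (profile `ρ ≥ 0`, `Σ_{a<N} ρ(a) ≤ W`, `2Wγ ≤ b`) is the length-`K` member
of a pinned box family at the pin `g^A_K`: take generation 47's `runFamily_exists` at that pin and overwrite its run of length `K` by `A`.
[folklore] -/
theorem exists_family_through
    (hβ : ∀ (k : ℕ) (p : Fin (k + 1) → ℝ),
      β k p = b + ∑ i : Fin (k + 1), ρ (k - i) * min (p (Fin.last k)) (|p (Fin.last k) - p i|))
    (hb : 0 < b) (hγ : 0 < γ) (hρ0 : ∀ a, 0 ≤ ρ a) (hρW : ∀ n, ∑ a ∈ range n, ρ a ≤ W) (hsmall : 2 * W * γ ≤ b)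
    {K : ℕ} {gA : ℕ → ℝ} (hA : RGEqH K β gA) (hAbox : ∀ k, k ≤ K → 0 < gA k ∧ gA k ≤ γ) :
    ∃ g : ℕ → ℕ → ℝ, (∀ L, RGEqH L β (g L)) ∧ (∀ L i, i ≤ L → 0 < g L i ∧ g L i ≤ γ) ∧ (∀ L, g L L = gA K) ∧ g K = gA := by
  obtain ⟨g₀, hrun, hbox, hpin⟩ := runFamily_exists hβ hb hγ hρ0 hρW hsmall (hAbox K le_rfl).1 (hAbox K le_rfl).2
  refine ⟨Function.update g₀ K gA, fun L => ?_, fun L i hi => ?_, fun L => ?_, Function.update_self K gA g₀⟩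
  · by_cases hL : L = K
    · subst hL
      rw [Function.update_self]
      exact hA
    · rw [Function.update_of_ne hL]
      exact hrun L
  · by_cases hL : L = K
    · subst hL
      rw [Function.update_self]
      exact hAbox i hi
    · rw [Function.update_of_ne hL]
      exact hbox L i hi
  · by_cases hL : L = K
    · subst hL
      rw [Function.update_self]
    · rw [Function.update_of_ne hL]
      exact hpin L

/-- **EMBEDDING TWO RUNS.**  Two box runs `A` (`K` steps) and `B` (`K + n` steps, `n ≠ 0`) of the family with matched infrared pin
`g^A_K = g^B_{K+n}` (`2Wγ ≤ b`) are the length-`K` and length-`(K+n)` members of ONE pinned box family. [folklore] -/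
theorem exists_family_through_two
    (hβ : ∀ (k : ℕ) (p : Fin (k + 1) → ℝ),
      β k p = b + ∑ i : Fin (k + 1), ρ (k - i) * min (p (Fin.last k)) (|p (Fin.last k) - p i|))
    (hb : 0 < b) (hγ : 0 < γ) (hρ0 : ∀ a, 0 ≤ ρ a) (hρW : ∀ n, ∑ a ∈ range n, ρ a ≤ W) (hsmall : 2 * W * γ ≤ b)
    {K n : ℕ} (hn : n ≠ 0) {gA gB : ℕ → ℝ} (hA : RGEqH K β gA) (hB : RGEqH (K + n) β gB)
    (hAbox : ∀ k, k ≤ K → 0 < gA k ∧ gA k ≤ γ) (hBbox : ∀ k, k ≤ K + n → 0 < gB k ∧ gB k ≤ γ) (hpin : gA K = gB (K + n)) :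
    ∃ g : ℕ → ℕ → ℝ, (∀ L, RGEqH L β (g L)) ∧ (∀ L i, i ≤ L → 0 < g L i ∧ g L i ≤ γ) ∧ (∀ L, g L L = gA K)
      ∧ g K = gA ∧ g (K + n) = gB := by
  obtain ⟨g₁, hrun, hbox, hpin1, hK⟩ := exists_family_through hβ hb hγ hρ0 hρW hsmall hA hAbox
  have hne : K ≠ K + n := by omega
  refine ⟨Function.update g₁ (K + n) gB, fun L => ?_, fun L i hi => ?_, fun L => ?_, ?_, Function.update_self (K + n) gB g₁⟩
  · by_cases hL : L = K + n
    · subst hL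
      rw [Function.update_self]
      exact hB
    · rw [Function.update_of_ne hL]
      exact hrun L
  · by_cases hL : L = K + n
    · subst hL
      rw [Function.update_self]
      exact hBbox i hi
    · rw [Function.update_of_ne hL]
      exact hbox L i hi
  · by_cases hL : L = K + n
    · subst hL
      rw [Function.update_self]
      exact hpin.symm
    · rw [Function.update_of_ne hL]
      exact hpin1 L
  · rw [Function.update_of_ne hne]
    exact hK

/-! ## §3 The family forms, read for arbitrary pinned runs -/

/-- **GENERAL SHIFT, TWO ARBITRARY RUNS: THE MATCHED DISCREPANCY IS NON-INCREASING IN THE POSITION.**  Two infrared-pinned box runs of the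
family, `A` with `K` steps and `B` with `K + n` steps (ANY `n`), `g^A_K = g^B_{K+n}`; profile `ρ ≥ 0` non-increasing on the positive ages,
`Σ_{a<N} ρ(a) ≤ W`, `4Wγ ≤ b`.  THEN for every `j < K`:
`1∕(g^B_{j+1+n})² − 1∕(g^A_{j+1})² ≤ 1∕(g^B_{j+n})² − 1∕(g^A_j)²`.
Generation 55's `disc_succ_le_disc` is the case `n = 1`; its family form `invSq_shift_mono_position`, read on the family through `A` and `B`
(`exists_family_through_two`) at infrared distance `m = K − (j+1)`, is the general case; `n = 0` is `0 ≤ 0` by `run_eq_of_pin`.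
[cite: Balaban1987RG1, (0.20) p.256, (0.31) and Thm 2 p.259] -/
theorem disc_shift_succ_le_disc_shift
    (hβ : ∀ (k : ℕ) (p : Fin (k + 1) → ℝ),
      β k p = b + ∑ i : Fin (k + 1), ρ (k - i) * min (p (Fin.last k)) (|p (Fin.last k) - p i|))
    (hb : 0 < b) (hγ : 0 < γ) (hρ0 : ∀ a, 0 ≤ ρ a) (hρW : ∀ n, ∑ a ∈ range n, ρ a ≤ W) (hmono : ∀ a, 1 ≤ a → ρ (a + 1) ≤ ρ a)
    (hWγ : 4 * (W * γ) ≤ b) {K n : ℕ} {gA gB : ℕ → ℝ} (hA : RGEqH K β gA) (hB : RGEqH (K + n) β gB)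
    (hAbox : ∀ k, k ≤ K → 0 < gA k ∧ gA k ≤ γ) (hBbox : ∀ k, k ≤ K + n → 0 < gB k ∧ gB k ≤ γ) (hpin : gA K = gB (K + n)) :
    ∀ j, j < K → 1 / (gB (j + 1 + n)) ^ 2 - 1 / (gA (j + 1)) ^ 2 ≤ 1 / (gB (j + n)) ^ 2 - 1 / (gA j) ^ 2 := by
  intro j hj
  rcases Nat.eq_zero_or_pos n with hn | hn
  · subst hn
    have e := run_eq_of_pin hβ hb hρ0 hA hB (fun k hk => (hAbox k hk).1) (fun k hk => (hBbox k hk).1) hpin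
    rw [show j + 1 + 0 = j + 1 from rfl, show j + 0 = j from rfl, e (j + 1) hj, e j hj.le, sub_self, sub_self]
  · have hW0 : 0 ≤ W := le_trans (by simp) (hρW 0)
    have hsmall : 2 * W * γ ≤ b := by nlinarith [mul_nonneg hW0 hγ.le]
    obtain ⟨g, hrun, hbox, hpin', hK, hKn⟩ :=
      exists_family_through_two hβ hb hγ hρ0 hρW hsmall (Nat.pos_iff_ne_zero.1 hn) hA hB hAbox hBbox hpin
    obtain ⟨m, rfl⟩ : ∃ m, K = j + 1 + m := ⟨K - (j + 1), by omega⟩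
    have h := invSq_shift_mono_position hβ hb hγ hρ0 hρW hmono hWγ hrun hbox hpin' m j n
    rw [invSq_def, invSq_def, invSq_def, invSq_def, show j + 1 + n + m = j + 1 + m + n by omega,
      show j + n + (m + 1) = j + 1 + m + n by omega, show j + (m + 1) = j + 1 + m by omega, hKn, hK] at h
    exact h

/-- **THE CONTINUUM CORRECTION GROWS TOWARDS THE ULTRAVIOLET END OF EVERY PINNED RUN.**  One ARBITRARY infrared-pinned box run `A` of the
family with `j + 1 + m` steps, and ANY pinned box family `g` of the family at the same pin (`g L L = g^A_{j+1+m}` for all `L`; its `astar` is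
THE continuum coupling of `(β, g_IR)` by `astar_eq_of_pin_eq`); profile non-increasing on the positive ages, `Σ_{a<N} ρ(a) ≤ W`, `4Wγ ≤ b`.
THEN `astar g m − 1∕(g^A_{j+1})² ≤ astar g (m+1) − 1∕(g^A_j)²` — generation 55's `astar_sub_invSq_mono_position` read on the family through
`A`, transported to `g` by family-independence. [cite: Balaban1987RG1, (0.20) p.256, (0.31) and Thm 2 p.259] -/
theorem astar_sub_invSq_run_mono
    (hβ : ∀ (k : ℕ) (p : Fin (k + 1) → ℝ),
      β k p = b + ∑ i : Fin (k + 1), ρ (k - i) * min (p (Fin.last k)) (|p (Fin.last k) - p i|))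
    (hb : 0 < b) (hγ : 0 < γ) (hρ0 : ∀ a, 0 ≤ ρ a) (hρW : ∀ n, ∑ a ∈ range n, ρ a ≤ W) (hmono : ∀ a, 1 ≤ a → ρ (a + 1) ≤ ρ a)
    (hWγ : 4 * (W * γ) ≤ b) {m j : ℕ} {gA : ℕ → ℝ} (hA : RGEqH (j + 1 + m) β gA)
    (hAbox : ∀ k, k ≤ j + 1 + m → 0 < gA k ∧ gA k ≤ γ) {g : ℕ → ℕ → ℝ} (hrun : ∀ L, RGEqH L β (g L))
    (hbox : ∀ L i, i ≤ L → 0 < g L i ∧ g L i ≤ γ) (hpin : ∀ L, g L L = gA (j + 1 + m)) :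
    astar g m - 1 / (gA (j + 1)) ^ 2 ≤ astar g (m + 1) - 1 / (gA j) ^ 2 := by
  have hW0 : 0 ≤ W := le_trans (by simp) (hρW 0)
  have hsmall : 2 * W * γ ≤ b := by nlinarith [mul_nonneg hW0 hγ.le]
  obtain ⟨g', hrun', hbox', hpin', hK⟩ := exists_family_through hβ hb hγ hρ0 hρW hsmall hA hAbox
  have hastar : astar g = astar g' :=
    astar_eq_of_pin_eq hβ hb hρ0 hrun hrun' (fun L i hi => (hbox L i hi).1) (fun L i hi => (hbox' L i hi).1) hpin hpin'
  have h := astar_sub_invSq_mono_position hβ hb hγ hρ0 hρW hmono hWγ hrun' hbox' hpin' m j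
  rw [invSq_def, invSq_def, show j + (m + 1) = j + 1 + m by omega, hK, ← hastar] at h
  exact h

end Summit.QuantumFields.BalabanUV.Beta.RemainderExplicitHistoryDiagonalEmbedding

end
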